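import Summits.Ventures.Crystal3D.Theorems.StickyWulffConstantTextureLiminfTexShadowFamSplitDefs
import Summits.Ventures.Crystal3D.Theorems.StickyWulffConstantTextureLiminfTexShadowFccDispatch
import Summits.Ventures.Crystal3D.Theorems.StickyWulffConstantTextureLiminfBilayerWallBookkeeping
import HarnessLib

/-!
# TexShadow v6.19 — `stub_famCoaxial` DERIVED from the three named debts {F-U, (β-iii), T-F2}, and `stub_bilayerWallDeficit` DERIVED from the
# Deficit-MIN payer pool (lane T, crux `TextureLiminf`, stmt-Ventures-19483; line `TexShadow`; cf-p1 DECISIONS (li) v6.19 plan, (lii) Deficit-MIN currency)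

HONEST FRAMING. Venture `Summits/Ventures/Crystal3D` (cell `crystal3d-full`), helper `--supports` the crux `TextureLiminf`
(stmt-Ventures-19483) of `route-Ventures-StickyWulffConstant`, registered line `TexShadow`.  Pure proofs (glue), standard axioms; inputs BY
NAME: `ExactOnly`(C12-55) [E1] at a slot star, `DoubleStarCoaxialAt`/`CapPairCoaxial` [from `StarPairFar`], and the four named debts of
`…TexShadowFamSplitDefs` as HYPOTHESES (`CoaxialUnifFrom` = F-U as T reads it, `BilayerWallBetaIIIFrom` = (β-iii)/L-2′,
`BilayerWallFaultedOnReachCoaxialFrom ∧ BilayerWallFaultedZigCoaxialFrom` = T-F2, `HStripPayerPoolFrom` = Deficit-MIN's certificate).  Nothing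
about those debts is proved here; rung credit only; F-C1 not moved.

* `bilayerWallAt_of_bothFcc_betaIII` — the dispatcher of `…TexShadowFccDispatch` with the (β-iii) hypothesis replaced by the NAMED carve-out
  `BilayerWallBetaIII C₃ R₀` (so no hypothesis on the pair beyond `BothFcc` + `hgen` remains);
* `onReachCoaxial_of_split`, `zigCoaxial_of_split` — at one thickness `R₀ ≥ 10`: `CoaxialUnifAt C_F R₀` + `BilayerWallBetaIII C₃ R₀` + the
  faulted class at `C_f` ⇒ the unrestricted class (`BilayerWallOnReachCoaxial` / `BilayerWallZigCoaxial`) at `max (…) `, by `BothFcc` / `¬BothFcc`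
  (the BothFcc branch does not even use the class words or `DomBy`);
* **`famCoaxial_of_dispatch`** — cf-p1 (li)(2) verbatim: `(∃ R, CoaxialUnifFrom R) → (∃ R, BilayerWallBetaIIIFrom R) → (∃ R, FaultedOnReach… R ∧
  FaultedZig… R) → ∃ R, BilayerWallOnReachCoaxialFrom R ∧ BilayerWallZigCoaxialFrom R` (= v6.17's `stub_famCoaxial` statement), mod E1/StarPairFar;
* **`bilayerWallDeficitMinFrom_of_pool`** — cf-p1 (lii)(1): `HStripPayerPoolFrom R → BilayerWallDeficitMinFrom (max R 3)` by
  `bilayerWallAt_of_payerBound` (= v6.14's `stub_bilayerWallDeficit` statement from the pool).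
So at the next cut `stub_famCoaxial` and `stub_bilayerWallDeficit` are THEOREMS from {stub_coaxialUnif [F-U], stub_betaIII [L-2′], stub_famFaulted
[T-F2], stub_hStripPayerPool [cf-p2 g20's certificate]} — every remaining T wall debt a named statement with an owner.
WHAT THIS IS NOT: no proof of F-U, (β-iii), T-F2 or the pool; F-C1 not moved.
-/

noncomputable section

open scoped BigOperators InnerProductSpace ENNReal
open MeasureTheory Filter

namespace Summit.Ventures.Crystal3D.Cruxes.TextureLiminf.TexShadow

open Summit.Ventures.Crystal3D Summit.Ventures.Crystal3D.Theorems
open Literature.MathematicalPhysics.StatisticalMechanics (IsHaggSeq fccStacking barlowStacking)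

open scoped Classical in
/-- **The `BothFcc` dispatcher with the NAMED (β-iii) carve-out.**  At `R₀ ≥ 10`: F-U's matrix at `C_F`, the carve-out at `C₃`, lane G's payer
pools and the zero cell give the cell inequality for EVERY presented `BothFcc` pair with bilayer frames, `hgen` and an admissible table. -/
theorem bilayerWallAt_of_bothFcc_betaIII
    {s₀ : E3} (hs₀ : s₀ ∈ fccSlots) (hcert : ExactOnly 0 (fccSlots.filter fun w => 0 < ⟪w, s₀⟫_ℝ))
    (hDS : ∀ G₁ G₂ : E3 ≃ₗᵢ[ℝ] E3, DoubleStarCoaxialAt G₁ G₂) (hCP : CapPairCoaxial)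
    {R₀ C_F C₃ : ℝ} (hR₀ : 10 ≤ R₀) (hFU : CoaxialUnifAt C_F R₀) (hIII : BilayerWallBetaIII C₃ R₀)
    {σ₁ σ₂ : ℤ → ℤ} (hσ₁ : IsHaggSeq σ₁) (hσ₂ : IsHaggSeq σ₂) (hfcc : BothFcc σ₁ σ₂)
    (L₁ L₂ : E3 ≃ₗᵢ[ℝ] E3) (s₁ s₂ : E3) {A₁ A₂ : ℤ → (E3 ≃ₗᵢ[ℝ] E3)} {u₁ u₂ : ℤ → E3}
    (hfr₁ : BilayerFramesAt L₁ s₁ σ₁ A₁ u₁) (hfr₂ : BilayerFramesAt L₂ s₂ σ₂ A₂ u₂)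
    (hgen : ∀ i j : ℤ, ¬ InResidualClass (A₁ i) (A₂ j) (u₁ i) (u₂ j))
    {c : ℤ → ℤ → ℝ} {m : ℤ → ℤ → E3} (hadm : BilayerChargeAdmissible A₁ A₂ c m) :
    BilayerWallAt (max (max (C_F + 60 * Real.sqrt 2 * Real.pi) ((2 * 2000 * (1 + 2 * (R₀ - 10)) + 3456 + 1152 * (R₀ + 1)) / 2)) C₃)
      R₀ σ₁ σ₂ L₁ L₂ s₁ s₂ c := by
  obtain ⟨P₁, P₂, -, -, hS₁, hS₂⟩ := exists_affine_fcc_pair_of_bothFcc L₁ L₂ s₁ s₂ hσ₁ hσ₂ hfcc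
  have hR0 : 0 ≤ R₀ := by linarith
  have hR1 : 1 ≤ R₀ := by linarith
  have hR3 : 3 ≤ R₀ := by linarith
  by_cases hco : CoAx P₁ P₂
  · by_cases hlin : P₁ '' fccRef = P₂ '' fccRef
    · -- (α=) zero cell
      have hz := bilayerWallAt_of_equal_linear hσ₁ hσ₂ hS₁ hS₂ hfr₁ hfr₂ hadm hlin R₀ hR3
      refine bilayerWallAt_mono hR0 (le_trans ?_ (le_trans (le_max_right _ _) (le_max_left _ _))) hz
      have : 0 ≤ 2 * 2000 * (1 + 2 * (R₀ - 10)) := by nlinarith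
      linarith
    · -- (α≠) lane F's uniform matrix
      obtain ⟨L, r₁, r₂, τ, τ', hτ, hτ', h₁, h₂, hcell⟩ :=
        hFU P₁ s₁ P₂ s₂ (affine_coax_of_coAx s₁ s₂ hco) (affine_ne_of_linear_ne hσ₁ hS₁ hlin)
      exact bilayerWallAt_mono hR0 (le_trans (le_max_left _ _) (le_max_left _ _))
        (bilayerWallAt_of_coaxialCell hσ₁ hσ₂ hS₁ hS₂ hfr₁ hfr₂ hadm hτ hτ' h₁ h₂ hR1 hcell)
  · by_cases hβ : (¬ Sigma9OneSidedAt (A₁ 0) (A₂ 0) ∧ ¬ Sigma9OneSidedDownAt (A₁ 0) (A₂ 0) ∧ ¬ Sigma9TiltAt (A₁ 0) (A₂ 0) ∧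
      ¬ Sigma9TiltDownAt (A₁ 0) (A₂ 0) ∧ ¬ Sigma9WideAt (A₁ 0) (A₂ 0) ∧ ¬ Sigma9WideDownAt (A₁ 0) (A₂ 0) ∧
      ¬ SeparatedWideAt (A₁ 0) (A₂ 0))
    · -- (β-i/ii) lane G's payer pools
      exact bilayerWallAt_mono hR0 (le_trans (le_max_right _ _) (le_max_left _ _))
        (bilayerWallAt_of_not_coAx_offSigma9 hs₀ hcert hDS hCP hσ₁ hσ₂ hS₁ hS₂ hfr₁ hfr₂ hadm hco (hgen 0 0) hβ hR₀)
    · -- (β-iii) the named carve-out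
      have hco' : ¬ CoAx (A₁ 0) (A₂ 0) := by
        rw [coAx_congr (bilayerFrame_image_eq hσ₁ hS₁ hfr₁ 0) (bilayerFrame_image_eq hσ₂ hS₂ hfr₂ 0)]; exact hco
      have hcells : Sigma9OneSidedAt (A₁ 0) (A₂ 0) ∨ Sigma9OneSidedDownAt (A₁ 0) (A₂ 0) ∨ Sigma9TiltAt (A₁ 0) (A₂ 0) ∨
          Sigma9TiltDownAt (A₁ 0) (A₂ 0) ∨ Sigma9WideAt (A₁ 0) (A₂ 0) ∨ Sigma9WideDownAt (A₁ 0) (A₂ 0) ∨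
          SeparatedWideAt (A₁ 0) (A₂ 0) := by
        by_contra h
        push Not at h
        exact hβ h
      exact bilayerWallAt_mono hR0 (le_max_right _ _)
        (hIII σ₁ σ₂ hσ₁ hσ₂ hfcc L₁ L₂ s₁ s₂ A₁ A₂ u₁ u₂ hfr₁ hfr₂ hgen c m hadm hco' hcells)

open scoped Classical in
/-- **The corner-keyed co-axial class at one thickness from the split** (`BothFcc` by the dispatcher, `¬BothFcc` by T-F2's half). -/
theorem onReachCoaxial_of_split
    {s₀ : E3} (hs₀ : s₀ ∈ fccSlots) (hcert : ExactOnly 0 (fccSlots.filter fun w => 0 < ⟪w, s₀⟫_ℝ))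
    (hDS : ∀ G₁ G₂ : E3 ≃ₗᵢ[ℝ] E3, DoubleStarCoaxialAt G₁ G₂) (hCP : CapPairCoaxial)
    {R₀ C_F C₃ C_f : ℝ} (hR₀ : 10 ≤ R₀) (hFU : CoaxialUnifAt C_F R₀) (hIII : BilayerWallBetaIII C₃ R₀)
    (hf : BilayerWallFaultedOnReachCoaxial C_f R₀) :
    BilayerWallOnReachCoaxial
      (max (max (max (C_F + 60 * Real.sqrt 2 * Real.pi) ((2 * 2000 * (1 + 2 * (R₀ - 10)) + 3456 + 1152 * (R₀ + 1)) / 2)) C₃) C_f)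
      R₀ := by
  intro σ₁ σ₂ hσ₁ hσ₂ L₁ L₂ s₁ s₂ A₁ A₂ u₁ u₂ hA₁ hA₂ hgen c m hadm hdom hcl
  have hR0 : 0 ≤ R₀ := by linarith
  by_cases hfcc : BothFcc σ₁ σ₂
  · exact bilayerWallAt_mono hR0 (le_max_left _ _)
      (bilayerWallAt_of_bothFcc_betaIII hs₀ hcert hDS hCP hR₀ hFU hIII hσ₁ hσ₂ hfcc L₁ L₂ s₁ s₂ hA₁ hA₂ hgen hadm)
  · exact bilayerWallAt_mono hR0 (le_max_right _ _)
      (hf σ₁ σ₂ hσ₁ hσ₂ hfcc L₁ L₂ s₁ s₂ A₁ A₂ u₁ u₂ hA₁ hA₂ hgen c m hadm hdom hcl)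

open scoped Classical in
/-- **The zig-keyed co-axial class at one thickness from the split.** -/
theorem zigCoaxial_of_split
    {s₀ : E3} (hs₀ : s₀ ∈ fccSlots) (hcert : ExactOnly 0 (fccSlots.filter fun w => 0 < ⟪w, s₀⟫_ℝ))
    (hDS : ∀ G₁ G₂ : E3 ≃ₗᵢ[ℝ] E3, DoubleStarCoaxialAt G₁ G₂) (hCP : CapPairCoaxial)
    {R₀ C_F C₃ C_f : ℝ} (hR₀ : 10 ≤ R₀) (hFU : CoaxialUnifAt C_F R₀) (hIII : BilayerWallBetaIII C₃ R₀)
    (hf : BilayerWallFaultedZigCoaxial C_f R₀) :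
    BilayerWallZigCoaxial
      (max (max (max (C_F + 60 * Real.sqrt 2 * Real.pi) ((2 * 2000 * (1 + 2 * (R₀ - 10)) + 3456 + 1152 * (R₀ + 1)) / 2)) C₃) C_f)
      R₀ := by
  intro σ₁ σ₂ hσ₁ hσ₂ L₁ L₂ s₁ s₂ A₁ A₂ u₁ u₂ hA₁ hA₂ hgen c m hadm hΔ₁ hΔ₂ hfl hoff hrow hzg hcl
  have hR0 : 0 ≤ R₀ := by linarith
  by_cases hfcc : BothFcc σ₁ σ₂
  · exact bilayerWallAt_mono hR0 (le_max_left _ _)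
      (bilayerWallAt_of_bothFcc_betaIII hs₀ hcert hDS hCP hR₀ hFU hIII hσ₁ hσ₂ hfcc L₁ L₂ s₁ s₂ hA₁ hA₂ hgen hadm)
  · exact bilayerWallAt_mono hR0 (le_max_right _ _)
      (hf σ₁ σ₂ hσ₁ hσ₂ hfcc L₁ L₂ s₁ s₂ A₁ A₂ u₁ u₂ hA₁ hA₂ hgen c m hadm hΔ₁ hΔ₂ hfl hoff hrow hzg hcl)

/-- **`stub_famCoaxial` from the three named debts** (cf-p1 (li)(2)): F-U + (β-iii) + T-F2 ⇒ `∃ R, OnReachCoaxialFrom R ∧ ZigCoaxialFrom R`,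
modulo E1 / `StarPairFar`. -/
theorem famCoaxial_of_dispatch
    {s₀ : E3} (hs₀ : s₀ ∈ fccSlots) (hcert : ExactOnly 0 (fccSlots.filter fun w => 0 < ⟪w, s₀⟫_ℝ))
    (hDS : ∀ G₁ G₂ : E3 ≃ₗᵢ[ℝ] E3, DoubleStarCoaxialAt G₁ G₂) (hCP : CapPairCoaxial)
    (hF : ∃ R : ℝ, CoaxialUnifFrom R) (hIII : ∃ R : ℝ, BilayerWallBetaIIIFrom R)
    (hFault : ∃ R : ℝ, BilayerWallFaultedOnReachCoaxialFrom R ∧ BilayerWallFaultedZigCoaxialFrom R) :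
    ∃ R : ℝ, BilayerWallOnReachCoaxialFrom R ∧ BilayerWallZigCoaxialFrom R := by
  obtain ⟨R_F, hF⟩ := hF
  obtain ⟨R₃, hIII⟩ := hIII
  obtain ⟨R_f, hfo, hfz⟩ := hFault
  refine ⟨max (max R_F 10) (max R₃ R_f), fun R₀ hR₀ => ?_, fun R₀ hR₀ => ?_⟩
  · have h10 : 10 ≤ R₀ := le_trans (le_trans (le_max_right _ _) (le_max_left _ _)) hR₀
    obtain ⟨C_F, hFU⟩ := hF R₀ (le_trans (le_trans (le_max_left _ _) (le_max_left _ _)) hR₀)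
    obtain ⟨C₃, h₃⟩ := hIII R₀ (le_trans (le_trans (le_max_left _ _) (le_max_right _ _)) hR₀)
    obtain ⟨C_f, hf⟩ := hfo R₀ (le_trans (le_trans (le_max_right _ _) (le_max_right _ _)) hR₀)
    exact ⟨_, onReachCoaxial_of_split hs₀ hcert hDS hCP h10 hFU h₃ hf⟩
  · have h10 : 10 ≤ R₀ := le_trans (le_trans (le_max_right _ _) (le_max_left _ _)) hR₀
    obtain ⟨C_F, hFU⟩ := hF R₀ (le_trans (le_trans (le_max_left _ _) (le_max_left _ _)) hR₀)
    obtain ⟨C₃, h₃⟩ := hIII R₀ (le_trans (le_trans (le_max_left _ _) (le_max_right _ _)) hR₀)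
    obtain ⟨C_f, hf⟩ := hfz R₀ (le_trans (le_trans (le_max_right _ _) (le_max_right _ _)) hR₀)
    exact ⟨_, zigCoaxial_of_split hs₀ hcert hDS hCP h10 hFU h₃ hf⟩

/-- **`stub_bilayerWallDeficit` from the Deficit-MIN payer pool** (cf-p1 (lii)(1)): `HStripPayerPoolFrom R ⇒ BilayerWallDeficitMinFrom (max R 3)`,
by `bilayerWallAt_of_payerBound`. -/
theorem bilayerWallDeficitMinFrom_of_pool {R : ℝ} (h : HStripPayerPoolFrom R) : BilayerWallDeficitMinFrom (max R 3) := by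
  intro R₀ hR₀
  have hR3 : 3 ≤ R₀ := le_trans (le_max_right _ _) hR₀
  obtain ⟨C, hpool⟩ := h R₀ (le_trans (le_max_left _ _) hR₀)
  refine ⟨(C + 3456 + 1152 * (R₀ + 1)) / 2, ?_⟩
  intro σ₁ σ₂ hσ₁ hσ₂ L₁ L₂ s₁ s₂ A₁ A₂ u₁ u₂ hA₁ hA₂ hgen c m hadm hZ hR₁ hR₂ hR₃' hR₄
  exact bilayerWallAt_of_payerBound hσ₁ hσ₂ L₁ L₂ s₁ s₂ R₀ C hR3 c
    (hpool σ₁ σ₂ hσ₁ hσ₂ L₁ L₂ s₁ s₂ A₁ A₂ u₁ u₂ hA₁ hA₂ hgen c m hadm hZ hR₁ hR₂ hR₃' hR₄)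

/-- `stub_bilayerWallDeficit` (v6.14 shape `∃ R, BilayerWallDeficitMinFrom R`) from the pool stub `∃ R, HStripPayerPoolFrom R`. -/
theorem bilayerWallDeficit_of_pool (h : ∃ R : ℝ, HStripPayerPoolFrom R) : ∃ R : ℝ, BilayerWallDeficitMinFrom R := by
  obtain ⟨R, hR⟩ := h
  exact ⟨max R 3, bilayerWallDeficitMinFrom_of_pool hR⟩

end Summit.Ventures.Crystal3D.Cruxes.TextureLiminf.TexShadow

end
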